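/-
  Summits/AtomisticToContinuum/Crystallization/Theorems/OverbindingBudgetAffineFarCensusCharge.lean

  residual stmt-AtomisticToContinuum-31280 · slot Z `FarAggregatePricing 12 (1/25) (1/2000) (1/(2·10⁷))` · the L-slot (Z3b⁗ `RechartedInflowWallLaw`,
  …FarRechart; its sitewise form Z3k `SitewiseRechartLoss`, …FarRechartKernel p844159; NF / FF, …FarRechartCoherence p844337; SM, …FarRechartShelter
  p844572; SM = LAB ∧ DRIFT, …FarMatchingSplit p845178): THE CENSUS CHARGE, PART B (decomp-a2c lens-4 «minimal counterexample / extremal reduction»,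
  generations 54–55).  Imports ONLY the tree files `…FarCensusChargeA` (part A: packing, ★ `farField_censusCharge`, typed pieces Z3b⁗' / Z3⁗') and
  `…FarMatchingSplit` (LAB / DRIFT).  0 sorry · 0 axiom · no instance · no notation · no option.
-/
import Summits.AtomisticToContinuum.Crystallization.Theorems.OverbindingBudgetAffineFarCensusChargeA
import Summits.AtomisticToContinuum.Crystallization.Theorems.OverbindingBudgetAffineFarMatchingSplit

/-! # The far field DISCHARGED, part B: the glue, ★ Z3b⁗' from the near field alone, the seam with the allowance, and slot Z from SIX leaves, none far-field

(Part A `…FarCensusChargeA`: `nearestDist_lb_of_good_not_scaleBad`, `sdiff_scaleBad_subset_goodSet_lift`, `sum_invPowSix_le_of_separated`,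
★ `farField_censusCharge`, and the typed pieces `RechartedInflowWallLawSb` / `RechartedTailTransferInfSb` / `RechartedTailTransferSelSb`.)

THE EXTREMAL REDUCTION (mechanism and the PROVED far-field census charge: part A).  A minimal counterexample to the L-slot in its
v10/v11 form had to beat the far field of a normal row UNIFORMLY IN THE WINDOW `δ` (FF / SFB / DC / DEV / QS — all L-heavy); seen from the SCALE
CENSUS the far field costs `30·C₁ε₁` per normal row plus `30·C₁ε₁` per SCALE-BAD good site (`farField_censusCharge`), i.e. `C'''ε₁·#Sh + cL·#sb` with
`cL` ARBITRARILY SMALL (`ε₁ ≤ cL/(30C₁)`); this part threads that allowance through the glue and lets the seam absorb `cL := p/2` into Z4″'s floor `p`.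

THE PIECES (v12′; primes = the tree statement + the allowance `+ cL·#sb`, `∀ cL > 0` quantified right after `R`, thresholds may depend on `cL`)
* Z3b⁗' · `RechartedInflowWallLawSb θ θ₀` [TYPED · WEAKER than the tree's Z3b⁗ `RechartedInflowWallLaw` (PROVED `rechartedInflowWallLawSb_of_wallLaw`:
  the allowance is nonnegative) · ★ PROVED FROM NF ALONE: `rechartedInflowWallLawSb_of_nearField : NearFieldRechartLoss θ θ₀ → RechartedInflowWallLawSb θ θ₀`
  (near field row by row from NF and the kernel double count `sum_defectKernel_le`, `C_T := A_N·2¹⁴/δ³`; far field by the census charge) — hence from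
  SM (`…_of_shelteredMatching`, tree `nearFieldRechartLoss_of_shelteredMatching`) and from SC ∧ IC (`…_of_coherence_cost`)].
* Z3⁗' · `RechartedTailTransferInfSb θ θ₀` / `RechartedTailTransferSelSb θ θ₀` [TYPED · WEAKER than Z3⁗ (PROVED `…InfSb_of_inf`) · glue PROVED:
  `rechartedTailTransferInfSb_of_drift_wallSb : θ ≤ 1/18 → TailDriftBound → RechartedInflowWallLawSb → RechartedTailTransferInfSb` (the tree glue
  `rechartedTailTransferInf_of_drift_wall` with the allowance threaded) and `rechartedTailTransferSelSb_of_inf` (ε₁-minimisers, `C' ↦ C' + 1`)].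
* SEAM' (PROVED) `farAggregatePricing_of_rechartedSeamSb : FarCoreExcess θ θ₀ κ → ShelteredCoreRegistration θ θ₀ → RechartedTailTransferSelSb θ θ₀ →
  ScaleBadFloor θ κ → θ ≤ 1/5 → FarAggregatePricing 12 θ θ₀ κ` — verbatim the v8 seam except that Z4″'s `p` is obtained FIRST, Z3⁗' is instantiated at
  `cL := p/2`, and the slot's scale-bad constant is `c := p/2`.
RECORDS: ★ `farAggregatePricing_record_of_leaves_census : Z2 → Zr‴a → Zr‴b → Z3a → SM → Z4″ → FarAggregatePricing 12 (1/25) (1/2000) (1/(2·10⁷))`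
(SIX leaves: `FarCoreExcess` CERT · `ShelteredFarCharting` M · `NormalCorePricing` S · `TailDriftBound` S/M · `ShelteredMatching` M/L·TRUE-type·ATTACKABLE ·
`ScaleBadFloor` M+CERT), the SC ∧ IC variant `farAggregatePricing_record_of_leaves_census'`, and ★ the v12″ record (critic row 866)
`farAggregatePricing_record_of_leaves_v12 : Z2 → Zr‴a → Zr‴b → Z3a → LAB → DRIFT → Z4″ → FarAggregatePricing 12 (1/25) (1/2000) (1/(2·10⁷))`
(SM replaced by the PROVED join `shelteredMatching_of_labelling_drift` of LAB `ShelteredLabelling` (rank 2, M) and DRIFT `LabelDriftBound` (S/M, generic)).  The far-field leaves FF / SFB / DC (and the g53 seeds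
DEV, QS, HOL, INJ below DC) LEAVE THE CONE: nothing undecided remains in the far field.

WHY EACH NEW PIECE IS STRICTLY WEAKER.  Z3b⁗' ⟸ Z3b⁗ and Z3⁗' ⟸ Z3⁗ formally (allowance `≥ 0`); strictly on paper: Z3b⁗ must price the far field of
every sheltered row against `#Gᶜ` and `#Sh` alone, i.e. it contains FF's wall-free funnel problem (generation-52/53 analysis: quasiconformal distortion
of defect-free `AffReg` matter), while Z3b⁗' may spend `cL` per scale-bad site — and a densifying wall-free funnel consists, below scale `0.95648`, of
SCALE-BAD good sites.  Neither FF nor Z3b⁗' implies the other formally (FF: sitewise, `+A·K_i`, no `#sb`; Z3b⁗': aggregate, `+cL·#sb`, no kernel in the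
far field), but Z3b⁗' is PROVED from NF and FF is not needed anywhere any more.
WHY NOVEL (vs v5 `ScaleBadPricing`, refuted q15673607 / critic row 762, and the v6–v11 doctrine «no tail mass of the normal class is charged to Z4″»):
v5 charged the WHOLE normal↔scale-bad tail interaction (`1.8–2.2·10⁻³` per site, above the scale-bad margin) to the scale-bad census; here ONLY the
far annulus beyond the drift radius is charged, and its mass per scale-bad site is `O(C₁ε₁)` — below ANY fixed margin `p` for `ε₁ ≤ p/(60C₁)`, which
the slot's quantifier order (`p` before `ε₀`, `ε₀` before `δ`) permits.  Versus g51–g53 (clear radius, quartic count, development): those priced or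
refined the far field SITEWISE; this removes it from the cone.  The lens: the minimal counterexample to the L-slot is now confined BELOW THE DRIFT
RADIUS of a normal row (SM's regime: rigidity of defect-free registered close packings at radius `≤ R_ε`, M/L, TRUE-type).
HIDDEN-GAUGE / DEGENERATE AUDIT: the census charge mentions no chart, no kernel, no shelter; `cL` is universally quantified BEFORE `D, C''', ε_W`
(so `ε_W` may depend on it) and AFTER `C, R` — the seam needs exactly one value `cL = p/2`; `sb = ∅` ⇒ Z3b⁗' is Z3b⁗ on scale-clean configurations
(still contentful below the drift radius: SM); `Sh = ∅` ⇒ `0 ≤ C_T#Gᶜ + cL#sb` (fine); the allowance cannot be dropped from the proof (the scale-bad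
columns are only `δ`-separated: their number within `ρ` of a row is `(2ρ/δ+1)³`, not absolute) — it is TRANSFERRED, not bounded; `N ≤ 1` vacuous.
-/

namespace Summit.AtomisticToContinuum.Crystallization.Theorems.OverbindingBudgetAffineFarSmoothSplit

open scoped BigOperators Classical
open Literature.MathematicalPhysics.StatisticalMechanics
open Literature.Geometry.DiscreteGeometry (nearestDist nearestDist_nonneg nearestDist_le_dist le_nearestDist nearestDist_def IsChargeFree)
open Summit.AtomisticToContinuum.Crystallization.Theorems.OverbindingBudgetBalancedCensusStatements
open Summit.AtomisticToContinuum.Crystallization.Theorems.OverbindingBudgetAffineLadder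
open Summit.AtomisticToContinuum.Crystallization.Theorems.OverbindingBudgetAffineLocalisation
open Summit.AtomisticToContinuum.Crystallization.Theorems.OverbindingBudgetMisfitCensusStatements (Bad Short Long)
open Summit.AtomisticToContinuum.Crystallization.Theorems.OverbindingBudgetViolatorDensityFloor (RT)

variable {N : ℕ}

/-! ## §3 (continued)  The glue with the allowance (PROVED): Z3a → Z3b⁗' → Z3⁗' -/

/-- **GLUE (PROVED): Z3a → Z3b⁗' → Z3⁗'** (`θ ≤ 1/18`; the tree glue `rechartedTailTransferInf_of_drift_wall` with the allowance threaded: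
`rechartTailInf ≤ refTail (F' i)`, Z3a at the recharted chart, `smoothTail G = smoothTail (M i) + smoothTail (G ∖ M i)`; `C' := C'' + C'''`). [this file] -/
theorem rechartedTailTransferInfSb_of_drift_wallSb {θ θ₀ : ℝ} (hθ : θ ≤ 1 / 18) (ha : TailDriftBound θ θ₀)
    (hb : RechartedInflowWallLawSb θ θ₀) : RechartedTailTransferInfSb θ θ₀ := by
  intro hR C hC R hR0 cL hcL
  obtain ⟨D, C''', εW, hD, hC''', hεW, hW⟩ := hb hR C hC R hR0 cL hcL
  obtain ⟨C'', εD, hC'', hεD, hA⟩ := ha hR C hC D hD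
  refine ⟨C'' + C''', min εD εW, add_nonneg hC'' hC''', lt_min hεD hεW, fun ε₁ hε₁ hε₁le δ hδ hδ2 => ?_⟩
  have hεD' : ε₁ ≤ εD := hε₁le.trans (min_le_left _ _)
  have hεW' : ε₁ ≤ εW := hε₁le.trans (min_le_right _ _)
  obtain ⟨CT, hCT, hW'⟩ := hW ε₁ hε₁ hεW' δ hδ hδ2
  refine ⟨CT, hCT, fun N y hy F hF => ?_⟩
  obtain ⟨F', M, π, hsel, hsum⟩ := hW' N y hy F hF
  set G := goodSet 12 ε₁ θ δ y
  set Sh := shelteredFarSet R θ₀ 12 ε₁ θ δ y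
  have hterm : ∀ i ∈ Sh, rechartTailInf θ (F i) - smoothTail G y i ≤ C'' * ε₁ + -smoothTail (G \ M i) y i := by
    intro i hi
    have hi12 := (mem_shelteredFarSet.mp hi).1
    obtain ⟨hrc, hMG, hmatch⟩ := hsel i hi
    have hch := hF i hi
    have hnn : |(F' i).nn - nearestDist y i| ≤ C * ε₁ * nearestDist y i := by rw [hrc.2.2.1]; exact hch.1.1
    have h1 : rechartTailInf θ (F i) ≤ refTail (F' i) := rechartTailInf_le_refTail_of_recharts hθ hrc
    have h2 : refTail (F' i) - smoothTail (M i) y i ≤ C'' * ε₁ :=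
      hA ε₁ hε₁ hεD' δ hδ hδ2 N y hy i hi12.1 hi12.2 (F' i) hrc.1 hnn (M i) (π i) hmatch
    have h3 : smoothTail G y i = smoothTail (M i) y i + smoothTail (G \ M i) y i := smoothTail_eq_add_sdiff hMG y i
    linarith
  have hsumle : ∑ i ∈ Sh, (rechartTailInf θ (F i) - smoothTail G y i) ≤ ∑ i ∈ Sh, (C'' * ε₁ + -smoothTail (G \ M i) y i) :=
    Finset.sum_le_sum hterm
  have hsplit : ∑ i ∈ Sh, (C'' * ε₁ + -smoothTail (G \ M i) y i)
      = (Sh.card : ℝ) * (C'' * ε₁) + ∑ i ∈ Sh, -smoothTail (G \ M i) y i := by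
    rw [Finset.sum_add_distrib, Finset.sum_const, nsmul_eq_mul]
  have hSh0 : (0 : ℝ) ≤ (Sh.card : ℝ) := Nat.cast_nonneg _
  show ∑ i ∈ Sh, (rechartTailInf θ (F i) - smoothTail G y i)
    ≤ CT * ((Gᶜ.card : ℕ) : ℝ) + (C'' + C''') * ε₁ * (Sh.card : ℝ) + cL * ((goodScaleBadSet 12 ε₁ θ δ y).card : ℝ)
  nlinarith [hsumle, hsplit, hsum, hSh0]

/-! ## §4  ★ Z3b⁗' from the NEAR FIELD ALONE (PROVED): the far field is the census charge -/

/-- ★ **`NearFieldRechartLoss ⇒ RechartedInflowWallLawSb` (PROVED)** — `D := D`, `C''' := C₃ + 30C₁`, `ε_W := min ε_N ((19/20)²/C₁) (cL/(30C₁))`,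
`C_T := A_N·2¹⁴/δ³`: the rechart and the matching of each sheltered row are NF's; its unmatched class splits into the NEAR field (NF, row by row;
the kernel terms are double-counted by `sum_defectKernel_le`) and the FAR field (`farField_censusCharge` with `T := Sh_R ⊆ G ∖ sb`:
`≤ 30C₁ε₁·#Sh_R + 30C₁ε₁·#sb ≤ 30C₁ε₁·#Sh_R + cL·#sb`).  No far-field leaf (FF, SFB, DC, …) is used. [this file] -/
theorem rechartedInflowWallLawSb_of_nearField {θ θ₀ : ℝ} (hN : NearFieldRechartLoss θ θ₀) : RechartedInflowWallLawSb θ θ₀ := by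
  intro hR C hC R hR0 cL hcL
  obtain ⟨C₁, D, C₃, εN, hC₁, hD, hC₃, hεN, hNF⟩ := hN hR C hC
  refine ⟨D, C₃ + 30 * C₁, min εN (min ((19 / 20) ^ 2 / C₁) (cL / (30 * C₁))), hD, by positivity,
    lt_min hεN (lt_min (by positivity) (by positivity)), fun ε₁ hε₁ hε₁le δ hδ hδ2 => ?_⟩
  have hεN' : ε₁ ≤ εN := hε₁le.trans (min_le_left _ _)
  have hCε : C₁ * ε₁ ≤ (19 / 20) ^ 2 := by
    have h := hε₁le.trans ((min_le_right _ _).trans (min_le_left _ _))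
    rw [le_div_iff₀ hC₁] at h; linarith
  have hcL' : 30 * C₁ * ε₁ ≤ cL := by
    have h := hε₁le.trans ((min_le_right _ _).trans (min_le_right _ _))
    rw [le_div_iff₀ (by positivity)] at h; linarith
  obtain ⟨A, hA, hN'⟩ := hNF ε₁ hε₁ hεN' δ hδ hδ2
  refine ⟨A * (2 ^ 14 / δ ^ 3), by positivity, fun N y hy F hF => ?_⟩
  set G := goodSet 12 ε₁ θ δ y with hG
  set sb := goodScaleBadSet 12 ε₁ θ δ y with hsb
  set Sh := shelteredFarSet R θ₀ 12 ε₁ θ δ y with hSh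
  -- row by row: NF's rechart, matching and near-field bound
  have hch : ∀ i : Fin N, ∃ (c' : Chart) (M : Finset (Fin N)) (π : Fin N → EuclideanSpace ℝ (Fin 3)), i ∈ Sh →
      Recharts θ (F i) c' ∧ M ⊆ G ∧ Matched D ε₁ y i c' M π ∧
        -smoothTail ((G \ M).filter fun k => C₁ * ε₁ * (dist (y i) (y k) / nearestDist y i) ^ 2 < 1) y i
          ≤ C₃ * ε₁ + A * defectKernel 12 ε₁ θ δ y i := by
    intro i
    by_cases hi : i ∈ Sh
    · obtain ⟨c', M, π, h1, h2, h3, h4⟩ :=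
        hN' N y hy i (shelteredFarSet_subset R θ₀ 12 ε₁ θ δ y hi) (F i) (hF i hi).1 (hF i hi).2
      exact ⟨c', M, π, fun _ => ⟨h1, h2, h3, h4⟩⟩
    · exact ⟨F i, ∅, fun _ => 0, fun h1 => absurd h1 hi⟩
  choose F' M π hF' using hch
  refine ⟨F', M, π, fun i hi => ⟨(hF' i hi).1, (hF' i hi).2.1, (hF' i hi).2.2.1⟩, ?_⟩
  -- the near/far split of each unmatched class
  have hsplit : ∀ i ∈ Sh, -smoothTail (G \ M i) y i
      = -smoothTail ((G \ M i).filter fun k => C₁ * ε₁ * (dist (y i) (y k) / nearestDist y i) ^ 2 < 1) y i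
        + -smoothTail ((G \ M i).filter fun k => ¬ C₁ * ε₁ * (dist (y i) (y k) / nearestDist y i) ^ 2 < 1) y i := by
    intro i _
    unfold smoothTail
    rw [← Finset.sum_filter_add_sum_filter_not (G \ M i) (fun k => C₁ * ε₁ * (dist (y i) (y k) / nearestDist y i) ^ 2 < 1)]
    ring
  -- near field: NF row by row and the kernel double count
  have hSG : Sh ⊆ G :=
    (shelteredFarSet_subset R θ₀ 12 ε₁ θ δ y).trans (Finset.sdiff_subset.trans (farSet_subset_goodSet θ₀ 12 ε₁ θ δ y))
  have hsumK : ∑ i ∈ Sh, defectKernel 12 ε₁ θ δ y i ≤ 2 ^ 14 / δ ^ 3 * ((Gᶜ.card : ℕ) : ℝ) :=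
    le_trans (Finset.sum_le_sum_of_subset_of_nonneg hSG fun i _ _ => defectKernel_nonneg 12 ε₁ θ δ y i) (sum_defectKernel_le hδ hδ2 hy)
  have hnear : ∑ i ∈ Sh, -smoothTail ((G \ M i).filter fun k => C₁ * ε₁ * (dist (y i) (y k) / nearestDist y i) ^ 2 < 1) y i
      ≤ C₃ * ε₁ * (Sh.card : ℝ) + A * (2 ^ 14 / δ ^ 3) * ((Gᶜ.card : ℕ) : ℝ) := by
    calc ∑ i ∈ Sh, -smoothTail ((G \ M i).filter fun k => C₁ * ε₁ * (dist (y i) (y k) / nearestDist y i) ^ 2 < 1) y i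
        ≤ ∑ i ∈ Sh, (C₃ * ε₁ + A * defectKernel 12 ε₁ θ δ y i) := Finset.sum_le_sum fun i hi => (hF' i hi).2.2.2
      _ = C₃ * ε₁ * (Sh.card : ℝ) + A * ∑ i ∈ Sh, defectKernel 12 ε₁ θ δ y i := by
          rw [Finset.sum_add_distrib, Finset.sum_const, nsmul_eq_mul, Finset.mul_sum]; ring
      _ ≤ C₃ * ε₁ * (Sh.card : ℝ) + A * (2 ^ 14 / δ ^ 3 * ((Gᶜ.card : ℕ) : ℝ)) :=
          add_le_add le_rfl (mul_le_mul_of_nonneg_left hsumK hA)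
      _ = C₃ * ε₁ * (Sh.card : ℝ) + A * (2 ^ 14 / δ ^ 3) * ((Gᶜ.card : ℕ) : ℝ) := by ring
  -- far field: the census charge on T := Sh ⊆ G ∖ sb
  have hShT : Sh ⊆ G \ sb := fun i hi => by
    have h := Finset.mem_sdiff.mp (shelteredFarSet_subset R θ₀ 12 ε₁ θ δ y hi)
    exact Finset.mem_sdiff.mpr ⟨farSet_subset_goodSet θ₀ 12 ε₁ θ δ y h.1, h.2⟩
  have hfar : ∑ i ∈ Sh, -smoothTail ((G \ M i).filter fun k => ¬ C₁ * ε₁ * (dist (y i) (y k) / nearestDist y i) ^ 2 < 1) y i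
      ≤ 30 * C₁ * ε₁ * ((Sh.card : ℝ) + (sb.card : ℝ)) :=
    farField_censusCharge hC₁ hε₁ hCε hδ hy hShT
      (fun i => (G \ M i).filter fun k => ¬ C₁ * ε₁ * (dist (y i) (y k) / nearestDist y i) ^ 2 < 1)
      (fun i _ => (Finset.filter_subset _ _).trans Finset.sdiff_subset)
      (fun i _ k hk => not_lt.mp (Finset.mem_filter.mp hk).2)
  -- total
  have hSh0 : (0 : ℝ) ≤ (Sh.card : ℝ) := Nat.cast_nonneg _
  have hsb0 : (0 : ℝ) ≤ (sb.card : ℝ) := Nat.cast_nonneg _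
  rw [Finset.sum_congr rfl hsplit, Finset.sum_add_distrib]
  show _ ≤ A * (2 ^ 14 / δ ^ 3) * ((Gᶜ.card : ℕ) : ℝ) + (C₃ + 30 * C₁) * ε₁ * (Sh.card : ℝ) + cL * (sb.card : ℝ)
  nlinarith [hnear, hfar, hcL', hSh0, hsb0, mul_le_mul_of_nonneg_right hcL' hsb0]

/-- **SM ⇒ Z3b⁗'** (through the tree's clear-radius node `nearFieldRechartLoss_of_shelteredMatching`). [this file] -/
theorem rechartedInflowWallLawSb_of_shelteredMatching {θ θ₀ : ℝ} (hS : ShelteredMatching θ θ₀) : RechartedInflowWallLawSb θ θ₀ :=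
  rechartedInflowWallLawSb_of_nearField (nearFieldRechartLoss_of_shelteredMatching hS)

/-- **SC ∧ IC ⇒ Z3b⁗'** (through the tree's LAYER 2 `nearFieldRechartLoss_of_coherence_cost`). [this file] -/
theorem rechartedInflowWallLawSb_of_coherence_cost {θ θ₀ : ℝ} (hC : ShortRangeCoherence θ θ₀) (hI : IncoherenceCost θ θ₀) :
    RechartedInflowWallLawSb θ θ₀ :=
  rechartedInflowWallLawSb_of_nearField (nearFieldRechartLoss_of_coherence_cost hC hI)

/-! ## §5  The seam with the allowance (PROVED): `c := p/2` -/
set_option maxHeartbeats 400000 in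
/-- **LAYER-5 SEAM' (PROVED, v12′):
`FarCoreExcess → ShelteredCoreRegistration → RechartedTailTransferSelSb → ScaleBadFloor → θ ≤ 1/5 → FarAggregatePricing 12 θ θ₀ κ`.**
Verbatim the tree's v8 seam `farAggregatePricing_of_rechartedSeam`, except: Z4″'s floor constant `p` is obtained FIRST, Z3⁗' is instantiated at the
allowance `cL := p/2`, and the slot's scale-bad constant is `c := p/2` (the scale-bad rows still clear `e⋆ + κ + p/2` after paying the sheltered
rows' far field facing them). [this file] -/
theorem farAggregatePricing_of_rechartedSeamSb {θ θ₀ κ : ℝ} (h2 : FarCoreExcess θ θ₀ κ) (hr : ShelteredCoreRegistration θ θ₀)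
    (h3 : RechartedTailTransferSelSb θ θ₀) (h4 : ScaleBadFloor θ κ) (hθ : θ ≤ 1 / 5) : FarAggregatePricing 12 θ θ₀ κ := by
  intro hR
  obtain ⟨m, τ, hm, hτ, hZ2⟩ := h2
  obtain ⟨R, C, C₂, εA, hR0, hC, hC₂, hεA, hZr⟩ := hr hR τ hτ
  obtain ⟨p, εC, hp, hεC, hZ4⟩ := h4 hR
  obtain ⟨C', εB, hC', hεB, hZ3⟩ := h3 hR C hC R hR0 (p / 2) (half_pos hp)
  have hden : 0 < C₂ + C' + 1 := by linarith
  refine ⟨min (min εA εB) (min εC (m / (C₂ + C' + 1))),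
    lt_min (lt_min hεA hεB) (lt_min hεC (div_pos hm hden)), fun ε₁ hε₁ hε₁le δ hδ hδ2 => ?_⟩
  have hεA' : ε₁ ≤ εA := hε₁le.trans ((min_le_left _ _).trans (min_le_left _ _))
  have hεB' : ε₁ ≤ εB := hε₁le.trans ((min_le_left _ _).trans (min_le_right _ _))
  have hεC' : ε₁ ≤ εC := hε₁le.trans ((min_le_right _ _).trans (min_le_left _ _))
  have hεm' : (C₂ + C') * ε₁ ≤ m := by
    have h1 := mul_le_mul_of_nonneg_left (hε₁le.trans ((min_le_right _ _).trans (min_le_right _ _))) hden.le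
    rw [mul_div_cancel₀ _ hden.ne'] at h1; nlinarith
  obtain ⟨CT, hCT, hZ3'⟩ := hZ3 ε₁ hε₁ hεB' δ hδ hδ2
  obtain ⟨C4, hC4, hZ4'⟩ := hZ4 ε₁ hε₁ hεC' δ hδ hδ2
  set e : ℝ := ⨅ Q : PeriodicConfiguration 3, Q.energyPerParticle lennardJones
  set K : ℝ := (4 * R / δ + 1) ^ 3 with hK
  set Crow : ℝ := 1024 / (12 * δ ^ 6) with hCrow
  have hK0 : 0 ≤ K := by positivity
  have hCrow0 : 0 ≤ Crow := by positivity
  have hA0 : 0 ≤ |e + κ| := abs_nonneg _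
  refine ⟨p / 2, CT + C4 + K * (Crow + |e + κ|), half_pos hp, by positivity, fun N y hy => ?_⟩
  set G := goodSet 12 ε₁ θ δ y
  set Far := farSet θ₀ 12 ε₁ θ δ y
  set sb := goodScaleBadSet 12 ε₁ θ δ y
  set Fn := Far \ sb
  set Sh := shelteredFarSet R θ₀ 12 ε₁ θ δ y
  set Un := Fn \ Sh
  have hsub : sb ⊆ Far := goodScaleBadSet_subset_farSet θ₀ 12 ε₁ θ δ y
  have hShFn : Sh ⊆ Fn := shelteredFarSet_subset R θ₀ 12 ε₁ θ δ y
  have hFarG : Far ⊆ G := farSet_subset_goodSet θ₀ 12 ε₁ θ δ y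
  have hUnG : Un ⊆ G := (Finset.sdiff_subset).trans ((Finset.sdiff_subset).trans hFarG)
  -- charts on the sheltered class
  have hch : ∀ i : Fin N, ∃ c : Chart, i ∈ Sh →
      IsChart C ε₁ y i c ∧ ChartAdmissible θ c ∧ PatternFar θ₀ τ c ∧
        refEnergy c - refTail c - C₂ * ε₁ ≤ smoothCore G y i := by
    intro i
    by_cases hi : i ∈ Sh
    · obtain ⟨c, hc⟩ := hZr ε₁ hε₁ hεA' δ hδ hδ2 N y hy i hi
      exact ⟨c, fun _ => hc⟩
    · exact ⟨⟨fun _ => 0, 0, 1, 1⟩, fun h => absurd h hi⟩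
  choose F hF using hch
  obtain ⟨F', hF', hT⟩ := hZ3' N y hy F fun i hi => let h := hF i hi; ⟨h.1, h.2.1⟩
  -- sheltered rows
  have hrows : ∑ i ∈ Sh, (e + κ + m - C₂ * ε₁ - (refTail (F' i) - smoothTail G y i))
      ≤ ∑ i ∈ Sh, (smoothCore G y i + smoothTail G y i) := by
    refine Finset.sum_le_sum fun i hi => ?_
    have h := hF i hi
    have hc' := hF' i hi
    have hz := hZ2 (F' i) hc'.1 (patternFar_of_recharts h.2.1 hθ hc' h.2.2.1)
    have hcore := core_eq_of_recharts h.2.1 hc'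
    linarith [h.2.2.2]
  have hconst : ∑ i ∈ Sh, (e + κ + m - C₂ * ε₁ - (refTail (F' i) - smoothTail G y i))
      = (Sh.card : ℝ) * (e + κ + m - C₂ * ε₁) - ∑ i ∈ Sh, (refTail (F' i) - smoothTail G y i) := by
    rw [Finset.sum_sub_distrib, Finset.sum_const, nsmul_eq_mul]
  have hShrows : ∑ i ∈ Sh, (smoothCore G y i + smoothTail G y i) = 1 / 2 * pairSum Sh G y :=
    sum_smoothCore_add_smoothTail Sh G y
  -- unsheltered rows: crude floor and packing count
  have hUnrows : -Crow * (Un.card : ℝ) ≤ 1 / 2 * pairSum Un G y := half_pairSum_ge_of_subset_goodSet hδ hy hUnG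
  have hUn : (Un.card : ℝ) ≤ K * ((Gᶜ.card : ℕ) : ℝ) := card_far_not_sheltered_le hR0 hδ hy
  have hUn1 : Crow * (Un.card : ℝ) ≤ Crow * (K * ((Gᶜ.card : ℕ) : ℝ)) := mul_le_mul_of_nonneg_left hUn hCrow0
  have hUn2 : (Un.card : ℝ) * (e + κ) ≤ |e + κ| * (K * ((Gᶜ.card : ℕ) : ℝ)) := by
    have h1 : (Un.card : ℝ) * (e + κ) ≤ (Un.card : ℝ) * |e + κ| := mul_le_mul_of_nonneg_left (le_abs_self _) (Nat.cast_nonneg _)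
    have h2 : (Un.card : ℝ) * |e + κ| ≤ K * ((Gᶜ.card : ℕ) : ℝ) * |e + κ| := mul_le_mul_of_nonneg_right hUn hA0
    linarith
  -- scale-bad rows
  have h4' := hZ4' N y hy
  -- the decomposition Far = Sh ∪ Un ∪ sb
  have hunion : Fn ∪ sb = Far := Finset.sdiff_union_of_subset hsub
  have hdisj : Disjoint Fn sb := Finset.sdiff_disjoint
  have hunion' : Sh ∪ Un = Fn := Finset.union_sdiff_of_subset hShFn
  have hdisj' : Disjoint Sh Un := Finset.disjoint_sdiff
  have hpair : pairSum Far G y = pairSum Sh G y + pairSum Un G y + pairSum sb G y := by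
    rw [← hunion, pairSum_union_left hdisj G y, ← hunion', pairSum_union_left hdisj' G y]
  have hcard : (Sh.card : ℝ) + (Un.card : ℝ) + (sb.card : ℝ) = (Far.card : ℝ) := by
    have h1 : Fn.card + sb.card = Far.card := Finset.card_sdiff_add_card_eq_card hsub
    have h2 : Un.card + Sh.card = Fn.card := Finset.card_sdiff_add_card_eq_card hShFn
    have h3 : Sh.card + Un.card + sb.card = Far.card := by omega
    exact_mod_cast h3
  have hSh0 : (0 : ℝ) ≤ (Sh.card : ℝ) := Nat.cast_nonneg _
  have hmSh : (C₂ + C') * ε₁ * (Sh.card : ℝ) ≤ m * (Sh.card : ℝ) := mul_le_mul_of_nonneg_right hεm' hSh0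
  show (Far.card : ℝ) * e + κ * (Far.card : ℝ) + p / 2 * (sb.card : ℝ) - (CT + C4 + K * (Crow + |e + κ|)) * ((Gᶜ.card : ℕ) : ℝ)
      ≤ 1 / 2 * pairSum Far G y
  rw [hpair, ← hcard]
  nlinarith [hrows, hconst, hShrows, h4', hT, hmSh, hSh0, hUnrows, hUn1, hUn2]

/-- The seam from the INFIMUM form of Z3⁗'. [this file] -/
theorem farAggregatePricing_of_rechartedSeamInfSb {θ θ₀ κ : ℝ} (h2 : FarCoreExcess θ θ₀ κ) (hr : ShelteredCoreRegistration θ θ₀)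
    (h3 : RechartedTailTransferInfSb θ θ₀) (h4 : ScaleBadFloor θ κ) (hθ : θ ≤ 1 / 5) : FarAggregatePricing 12 θ θ₀ κ :=
  farAggregatePricing_of_rechartedSeamSb h2 hr (rechartedTailTransferSelSb_of_inf h3) h4 hθ

/-! ## §6  The records: slot Z of record from SIX leaves, none of them far-field -/

/-- **The node, general parameters**: `θ ≤ 1/18 → FarCoreExcess → ShelteredCoreRegistration → TailDriftBound → NearFieldRechartLoss → ScaleBadFloor →
FarAggregatePricing 12 θ θ₀ κ` (seam' ∘ glue' ∘ ★). [this file] -/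
theorem farAggregatePricing_of_nearField {θ θ₀ κ : ℝ} (hθ : θ ≤ 1 / 18) (h2 : FarCoreExcess θ θ₀ κ) (hr : ShelteredCoreRegistration θ θ₀)
    (h3a : TailDriftBound θ θ₀) (hN : NearFieldRechartLoss θ θ₀) (h4 : ScaleBadFloor θ κ) : FarAggregatePricing 12 θ θ₀ κ :=
  farAggregatePricing_of_rechartedSeamInfSb h2 hr
    (rechartedTailTransferInfSb_of_drift_wallSb hθ h3a (rechartedInflowWallLawSb_of_nearField hN)) h4 (hθ.trans (by norm_num))

/-- ★ **SLOT Z OF RECORD FROM SIX LEAVES (v12′):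
`FarCoreExcess ∧ ShelteredFarCharting ∧ NormalCorePricing ∧ TailDriftBound ∧ ShelteredMatching ∧ ScaleBadFloor ⇒
FarAggregatePricing 12 (1/25) (1/2000) (1/(2·10⁷))`** — Z2 (CERT) · Zr‴a (M) · Zr‴b (S) · Z3a (S/M) · SM (M/L · TRUE-type · ATTACKABLE) · Z4″ (M+CERT);
the `hZ` slot of the tree cone `tbdsg_of_nearCritical_record'_bt_d`.  No far-field leaf. [this file] -/
theorem farAggregatePricing_record_of_leaves_census
    (h2 : FarCoreExcess (1 / 25) (1 / 2000) (1 / (2 * 10 ^ 7)))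
    (hra : ShelteredFarCharting (1 / 25) (1 / 2000)) (hrb : NormalCorePricing (1 / 25))
    (h3a : TailDriftBound (1 / 25) (1 / 2000)) (hS : ShelteredMatching (1 / 25) (1 / 2000))
    (h4 : ScaleBadFloor (1 / 25) (1 / (2 * 10 ^ 7))) :
    FarAggregatePricing 12 (1 / 25) (1 / 2000) (1 / (2 * 10 ^ 7)) :=
  farAggregatePricing_of_nearField (by norm_num) h2 (shelteredCoreRegistration_record_of_charting_pricing hra hrb) h3a
    (nearFieldRechartLoss_of_shelteredMatching hS) h4

/-- **The seven-leaf variant with SM split as SC ∧ IC** (both M-class; the tree's LAYER 2). [this file] -/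
theorem farAggregatePricing_record_of_leaves_census'
    (h2 : FarCoreExcess (1 / 25) (1 / 2000) (1 / (2 * 10 ^ 7)))
    (hra : ShelteredFarCharting (1 / 25) (1 / 2000)) (hrb : NormalCorePricing (1 / 25))
    (h3a : TailDriftBound (1 / 25) (1 / 2000)) (hC : ShortRangeCoherence (1 / 25) (1 / 2000))
    (hI : IncoherenceCost (1 / 25) (1 / 2000)) (h4 : ScaleBadFloor (1 / 25) (1 / (2 * 10 ^ 7))) :
    FarAggregatePricing 12 (1 / 25) (1 / 2000) (1 / (2 * 10 ^ 7)) :=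
  farAggregatePricing_of_nearField (by norm_num) h2 (shelteredCoreRegistration_record_of_charting_pricing hra hrb) h3a
    (nearFieldRechartLoss_of_coherence_cost hC hI) h4

/-- ★ **SLOT Z OF RECORD, LEAF LIST v12″ (critic row 866)**:
`FarCoreExcess ∧ ShelteredFarCharting ∧ NormalCorePricing ∧ TailDriftBound ∧ ShelteredLabelling ∧ LabelDriftBound ∧ ScaleBadFloor ⇒
FarAggregatePricing 12 (1/25) (1/2000) (1/(2·10⁷))` — Z2 (CERT) · Zr‴a (M) · Zr‴b (S) · Z3a (S/M) · LAB (M · rank 2 · TRUE-type · INSTRUMENTABLE) ·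
DRIFT (S/M · GENERIC · prover-ready) · Z4″ (M+CERT); SM is the proved join `shelteredMatching_of_labelling_drift` (…FarMatchingSplit). [this file] -/
theorem farAggregatePricing_record_of_leaves_v12
    (h2 : FarCoreExcess (1 / 25) (1 / 2000) (1 / (2 * 10 ^ 7)))
    (hra : ShelteredFarCharting (1 / 25) (1 / 2000)) (hrb : NormalCorePricing (1 / 25))
    (h3a : TailDriftBound (1 / 25) (1 / 2000)) (hL : ShelteredLabelling (1 / 25) (1 / 2000)) (hD : LabelDriftBound)
    (h4 : ScaleBadFloor (1 / 25) (1 / (2 * 10 ^ 7))) :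
    FarAggregatePricing 12 (1 / 25) (1 / 2000) (1 / (2 * 10 ^ 7)) :=
  farAggregatePricing_record_of_leaves_census h2 hra hrb h3a (shelteredMatching_of_labelling_drift hL hD) h4

end Summit.AtomisticToContinuum.Crystallization.Theorems.OverbindingBudgetAffineFarSmoothSplit
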